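import Summits.QuantumFields.BalabanUV.T4Continuum.Support.NE9CurveFromBackgroundMap
import Summits.QuantumFields.BalabanUV.T4Continuum.Support.NE9Lemma1CurveSpeciesAdditive

/-!
# NE9CurveFromBackgroundMapAdditive — crew row (w19)'s slice-curve regularity pair `hcurA` ∕ `hcurC` DISCHARGED for curves of
# Bałaban's shape `σ′ ↦ Ψ_X(σ′ • B)`: from two GLOBAL ray binders on the shift field and the background-map TYPE facts (Ψ1)–(Ψ2);
# whence S3 ∧ S4 ∧ S5 for the composite curve species (cell `pub-balaban`, T4-DAG §2 node U3 ∕ §6 NE9; NE9 formalisation swarm,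
# unit `b2b-balaban-t4-ne9-formalise-leaf-06` gen 8; own-initiative micro-item «CUR-COMP-S3», CLAIMS.log l.11380; the S-side twin of
# leaf-05-g5's «CUR-BG» `NE9CurveFromBackgroundMap` (A3 side), at own risk)

HONEST FRAMING (T4-DAG PAGE 1).  Rung (B)+1 of the FINITE-VOLUME T⁴ programme — existence AND uniqueness of the ε → 0 limit
of gauge-invariant observables on a fixed torus; NOT infinite volume, NOT a mass gap, NOT the Clay problem.  NE9
(`T4OutputRate.NE9` ∧ `FadingMemory`) is a cell NEW ESTIMATE, NOT PRINTED, and is NOT discharged here («NE9 ⇐ the named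
binders»); spine 0∕9; 0∕18 skeleton leaves instantiated on Bałaban's objects (O-NE9-1).  HONEST DEPENDENCY (cell line,
verbatim): continuum YM on T⁴ ⇐ BetaPertH ∧ nine spine estimates (0/9 proved); BetaPertH ⇐ (D1) ∧ (D4) ∧ CAP+tail; G-an2-4
gates asym, D1 and NE2/3/4.  [I] = [Balaban1987RG1] (CMP **109**), [II] = [Balaban1988RG2Cluster] (CMP **116**) are quoted for
TYPES only (ABSOLUTE RULE: nothing printed in the audited series is asserted).  No `def`, no Prop-valued definition;
`FlowStep.BetaPertH`, (B), (B^μ) do not occur.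

WHERE THIS SITS.  The row owner's located correction O-ne9p1g25-1 re-typed the displayed species of [II] §1 with analytic SLICE
CURVES (`CurData`, p213869); leaf-05-g5's CUR-BG (`NE9CurveFromBackgroundMap`, p215194) built the curve datum OF BAŁABAN'S SHAPE
`RemData.compCur D Ψ R′` — slice curve `τ ↦ Ψ_X(τ • D.dir … t s σ)`, the ray in the shift field `B = B(t, s, σ)` of [II]
(1.1)∕(1.23) composed with the background map `Ψ_X : B ↦ (chart of) U_j(□₀, exp iB)|_X` of [I] (3.30)∕(3.37), slice radius
`R_X∕dirB`, old-term radius `R′_X` — proved `CurData.Admissible` for it (`admissible_compCur`) and DISCHARGED leaf A3's slice-curve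
binders (c1)–(c3).  Crew row (w19) (`NE9Lemma1CurveSpeciesAdditive`, AUTHOR leaf-08-g4, in the tree as p215330) PROVED S3
`PieceAdditiveOn (analyticClass D.R) D.toC` for ANY curve datum modulo the SLICE-CURVE REGULARITY PAIR: `hcurA` — EVERYWHERE (not
only on the contours) the slice curve is analytic on its disc and maps it into the analyticity ball of its source — and `hcurC` —
the curve family is jointly continuous in `(t, s′, σ′, τ)` on (everything ×) the unit slice circle.  THIS FILE discharges that pair
for `D.compCur Ψ R′` from: **`hdirC`** — (w16)'s GLOBAL joint continuity of the shift-field directions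
(`NE9Lemma1RemainderSpeciesAdditive.sBinders_rem`, p213082, verbatim); **`hdirB`** — the GLOBAL size `‖D.dir … t s′ σ′‖ ≤ dirB`
(the EVERYWHERE form of `RemData.Admissible.dir_le`, which asks it on the contours only — the same harmless convention as (w19)'s
`hcurA` vs `CurData.Admissible.cur_an`; TYPE [II] (1.21)∕(1.22) p. 7 *"|𝐇_k(s(Y₀), B′)| ≦ …"*); the displayed `0 < dirB` (as in the
owner's `RemData.Admissible.toCur` and CUR-BG); and CUR-BG's background-map TYPE facts **(Ψ1)** `Ψ_X` analytic on the field ball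
`‖B‖ < R_X` ([I] (3.37) p. 277) and **(Ψ2)** `Ψ_X` maps it into the chart ball `‖·‖ < R′_X` ([I] Lemma 4 (3.53) p. 280, the
DOMAIN INCLUSION) — asserted for nothing of Bałaban's.
* §1 **`curA_compCur`** (`hdirB` + `0 < dirB` + (Ψ1) + (Ψ2) ⟹ `hcurA` in (w19)'s EXACT SHAPE: on `|τ| < R_X∕dirB` the ray stays
  in the field ball — `mapsTo_ray` — so the composite is analytic, `(Ψ1) ∘ ray`, and lands in the chart ball by (Ψ2));
  **`curC_compCur`** (`hdirC` + `hdirB` + `RemData.Admissible.dirB_lt` + (Ψ1) ⟹ `hcurC` in (w19)'s EXACT SHAPE: on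
  `univ ×ˢ {|τ| = 1}` one has `‖τ • B‖ = ‖B‖ ≤ dirB < R_X`, inside the ball where `Ψ_X` is continuous).
* §2 **`pieceAdditiveOn_compCur`** ∕ **`sBinders_compCur`** — (w19)'s `pieceAdditiveOn_cur` ∕ `sBinders_cur` at
  `admissible_compCur` fed with §1: S3, resp. S3 ∧ S4 ∧ S5, for `cpieceChannel (D.compCur Ψ R′).toC` on `analyticClass R′` with
  the weight `weightOf (D.compCur Ψ R′).toC.frame κ₁ d₀ O1 ((D.compCur Ψ R′).Kp c_dir)` and profile `tauOfG c_Q ℓ′`.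
* §3 RAY CONSISTENCY (`example`): at `Ψ := fun _ => id`, `R′ := D.R` (`compCur_id`, `RemData.toCur_toC` — both `rfl`) §2 yields
  the conclusion of (w16)'s `sBinders_rem` for `D.toC`; the GLOBAL conventions compare as `hdirB ∧ dirB < R ⟹ hdirR` (ours is the
  stronger pair, needed because the slice disc has radius `R_X∕dirB > 1`, not 1).
So, for curves of Bałaban's shape, the curve species' S3–S5 are KERNEL AT FORM LEVEL modulo: `RemData.Admissible`, (`hdirC`,
`hdirB`, `0 < dirB`) on the shift field, (Ψ1)–(Ψ2) on the background map, the level counts and scalars — the S-side companion of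
CUR-BG's A3 reduction (which adds (d1)–(d2), `hhalf`, (Ψ3)).  NOT PRINTED and not claimed: that Bałaban's 𝐇_k, U_j(□₀, exp iB) and
U^c_j meet these binders (O-NE9-1).  DISGUISE TEST: one species' channel-structure binders; no history comparison; not NE9.

WHAT IS PROVED (kernel, `[folklore]`; 0 sorry, 0 def): §1 `smul_mem_ball_of_norm_le`, `curA_compCur`, `curC_compCur`; §2
`pieceAdditiveOn_compCur`, `sBinders_compCur`; §3 one `example`.

References (TYPES only): [Balaban1987RG1] T. Bałaban, CMP **109** (1987) 249–301, (3.30) p. 276, (3.37) p. 277, Lemma 4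
(3.53)–(3.54) p. 280; [Balaban1988RG2Cluster] T. Bałaban, CMP **116** (1988) 1–22, (1.21)–(1.23) p. 7.  Summits-side NEW work
(LEAN PLACEMENT RULE); imports leaf-05-g5's `NE9CurveFromBackgroundMap` and leaf-08-g4's `NE9Lemma1CurveSpeciesAdditive` BY NAME;
modifies nothing; no END face re-wired.  Value = a binder reduction (S3–S5 for the composite curve species), NOT summit progress.
-/

noncomputable section

namespace Summit.QuantumFields.BalabanUV.T4Continuum.NE9CurveFromBackgroundMapAdditive

open scoped BigOperators
open Metric Set
open Literature.MathematicalPhysics.QuantumFieldTheory.Balaban1983to89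
open Literature.MathematicalPhysics.QuantumFieldTheory.Balaban1983to89.T4OutputRate
open Literature.MathematicalPhysics.QuantumFieldTheory.Balaban1983to89.T4HistoryLipschitzRecursion
open Summit.QuantumFields.BalabanUV.T4Continuum.NE9Lemma1Counting
open Summit.QuantumFields.BalabanUV.T4Continuum.NE9Lemma1Gain
open Summit.QuantumFields.BalabanUV.T4Continuum.NE9Lemma1PieceClass
open Summit.QuantumFields.BalabanUV.T4Continuum.NE9Lemma1RemainderSpecies
open Summit.QuantumFields.BalabanUV.T4Continuum.NE9Lemma1CurveRemainder
open Summit.QuantumFields.BalabanUV.T4Continuum.NE9Lemma1CurveSpecies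
open Summit.QuantumFields.BalabanUV.T4Continuum.NE9Lemma1CurveSpeciesAdditive (pieceAdditiveOn_cur sBinders_cur)
open Summit.QuantumFields.BalabanUV.T4Continuum.NE9CurveFromBackgroundMap (compCur_id admissible_compCur)
open Summit.QuantumFields.BalabanUV.T4Continuum.NE9ComplexEncoding (doubleCarriers)

variable {C : Carriers} {E : Type} [NormedAddCommGroup E] [NormedSpace ℂ E] {ι α β γ δ : Type}

/-! ## §1 The (w19) regularity pair for the composite datum from GLOBAL ray binders and (Ψ1)–(Ψ2) -/

/-- On the unit slice circle a direction of size `≤ a < R` stays in the open `R`-ball: `‖τ‖ = 1`, `‖A‖ ≤ a`, `a < R` ⟹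
`τ • A ∈ ball 0 R`. [folklore] -/
theorem smul_mem_ball_of_norm_le {A : E} {a R : ℝ} {τ : ℂ} (hτ : τ ∈ sphere (0:ℂ) 1) (hA : ‖A‖ ≤ a) (haR : a < R) :
    τ • A ∈ ball (0:E) R := by
  have h1 : ‖τ‖ = 1 := by simpa using hτ
  rw [mem_ball_zero_iff, norm_smul, h1, one_mul]
  exact hA.trans_lt haR

/-- **(w19)'s `hcurA` FOR THE COMPOSITE DATUM (kernel)**: from the GLOBAL size of the shift-field directions `hdirB : ‖D.dir …
t s′ σ′‖ ≤ dirB` (the everywhere form of `RemData.Admissible.dir_le`; TYPE [II] (1.21)∕(1.22) p. 7), the displayed `0 < dirB`,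
and the background-map TYPE facts (Ψ1) `Ψ_X` analytic on the field ball `‖B‖ < R_X` ([I] (3.37)) and (Ψ2) `Ψ_X` maps it into the
chart ball `‖·‖ < R′_X` ([I] Lemma 4 (3.53)): EVERYWHERE the composite slice curve `τ ↦ Ψ_X(τ • D.dir …)` is analytic on the slice
disc `|τ| < R_X∕dirB` and maps it into `ball 0 (R′_X)` — LITERALLY the `hcurA` hypothesis of `NE9Lemma1CurveSpeciesAdditive.
pieceAdditiveOn_cur` ∕ `sBinders_cur` at `D.compCur Ψ R′`. [cite: Balaban1987RG1, (3.37) p.277, (3.53) p.280; Balaban1988RG2Cluster, (1.21)-(1.22) p.7] -/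
theorem curA_compCur {D : RemData C E ι α β γ δ}
    (hdirB : ∀ k s y a b x t s' σ', ‖D.dir k s y a b x t s' σ'‖ ≤ D.dirB k s y a b x)
    (hpos : ∀ k s y a b x, 0 < D.dirB k s y a b x) {Ψ : C.Dom → E → E} {R' : C.Dom → ℝ}
    (hΨan : ∀ X, DifferentiableOn ℂ (Ψ X) (ball 0 (D.R X))) (hΨmaps : ∀ X, MapsTo (Ψ X) (ball 0 (D.R X)) (ball 0 (R' X))) :
    ∀ k s y a b x t s' σ', DifferentiableOn ℂ ((D.compCur Ψ R').cur k s y a b x t s' σ')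
        (ball 0 ((D.compCur Ψ R').ϱ k s y a b x)) ∧
      MapsTo ((D.compCur Ψ R').cur k s y a b x t s' σ') (ball 0 ((D.compCur Ψ R').ϱ k s y a b x))
        (ball 0 ((D.compCur Ψ R').R x.1)) := by
  intro k s y a b x t s' σ'
  have hray : MapsTo (fun τ : ℂ => τ • D.dir k s y a b x t s' σ') (ball (0:ℂ) (D.R x.1 / D.dirB k s y a b x))
      (ball (0:E) (D.R x.1)) :=
    mapsTo_ray (hdirB k s y a b x t s' σ') (hpos k s y a b x)
  exact ⟨(hΨan x.1).comp (differentiableOn_ray _ _) hray, (hΨmaps x.1).comp hray⟩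

/-- **(w19)'s `hcurC` FOR THE COMPOSITE DATUM (kernel)**: from (w16)'s GLOBAL joint continuity of the shift-field directions
`hdirC` (`NE9Lemma1RemainderSpeciesAdditive.sBinders_rem`, verbatim), the global size `hdirB`, `dirB < R_X` of
`RemData.Admissible`, and (Ψ1) (continuity of `Ψ_X` on the field ball suffices): the composite slice-curve family `(t, s′, σ′, τ)
↦ Ψ_X(τ • D.dir … t s′ σ′)` is jointly continuous on `univ ×ˢ {|τ| = 1}` (there `‖τ • B‖ = ‖B‖ ≤ dirB < R_X`) — LITERALLY the
`hcurC` hypothesis of `pieceAdditiveOn_cur` ∕ `sBinders_cur` at `D.compCur Ψ R′`.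
[cite: Balaban1987RG1, (3.37) p.277; Balaban1988RG2Cluster, (1.21)-(1.23) p.7] -/
theorem curC_compCur {D : RemData C E ι α β γ δ} {ℓ : ℕ → ℕ → ℝ} {cdir d0 : ℝ} (hD : D.Admissible ℓ cdir d0)
    (hdirC : ∀ k s y a b x, Continuous fun p : ℂ × (δ → ℝ) × (δ → ℂ) => D.dir k s y a b x p.1 p.2.1 p.2.2)
    (hdirB : ∀ k s y a b x t s' σ', ‖D.dir k s y a b x t s' σ'‖ ≤ D.dirB k s y a b x)
    {Ψ : C.Dom → E → E} (R' : C.Dom → ℝ) (hΨan : ∀ X, DifferentiableOn ℂ (Ψ X) (ball 0 (D.R X))) :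
    ∀ k s y a b x, ContinuousOn
      (fun q : (ℂ × (δ → ℝ) × (δ → ℂ)) × ℂ => (D.compCur Ψ R').cur k s y a b x q.1.1 q.1.2.1 q.1.2.2 q.2)
        (univ ×ˢ sphere (0:ℂ) 1) := by
  intro k s y a b x
  show ContinuousOn (fun q : (ℂ × (δ → ℝ) × (δ → ℂ)) × ℂ => Ψ x.1 (q.2 • D.dir k s y a b x q.1.1 q.1.2.1 q.1.2.2))
    (univ ×ˢ sphere (0:ℂ) 1)
  have hray : Continuous fun q : (ℂ × (δ → ℝ) × (δ → ℂ)) × ℂ => q.2 • D.dir k s y a b x q.1.1 q.1.2.1 q.1.2.2 :=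
    continuous_snd.smul ((hdirC k s y a b x).comp continuous_fst)
  refine (hΨan x.1).continuousOn.comp hray.continuousOn fun q hq => ?_
  exact smul_mem_ball_of_norm_le hq.2 (hdirB k s y a b x q.1.1 q.1.2.1 q.1.2.2) (hD.dirB_lt k s y a b x)

/-! ## §2 S3 ∧ S4 ∧ S5 for the composite curve species -/

variable [DecidableEq δ]

/-- **S3 FOR CURVES OF BAŁABAN'S SHAPE (kernel)**: `PieceAdditiveOn (analyticClass R′) (D.compCur Ψ R′).toC` — (w19)'s
`pieceAdditiveOn_cur` at the composite datum, its `κ₁ > 0` ∕ `r_k > 0` ∕ `ϱ > 1` taken from `admissible_compCur` (CUR-BG) and its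
regularity pair from §1: displayed after this are `RemData.Admissible`, `hdirC`, `hdirB`, `0 < dirB`, (Ψ1), (Ψ2) only.
[cite: Balaban1987RG1, (3.37) p.277, (3.53) p.280; Balaban1988RG2Cluster, (1.21)-(1.23) p.7] -/
theorem pieceAdditiveOn_compCur {D : RemData C E ι α β γ δ} {ℓ : ℕ → ℕ → ℝ} {cdir d0 : ℝ} (hD : D.Admissible ℓ cdir d0)
    (hpos : ∀ k s y a b x, 0 < D.dirB k s y a b x)
    (hdirC : ∀ k s y a b x, Continuous fun p : ℂ × (δ → ℝ) × (δ → ℂ) => D.dir k s y a b x p.1 p.2.1 p.2.2)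
    (hdirB : ∀ k s y a b x t s' σ', ‖D.dir k s y a b x t s' σ'‖ ≤ D.dirB k s y a b x)
    {Ψ : C.Dom → E → E} {R' : C.Dom → ℝ}
    (hΨan : ∀ X, DifferentiableOn ℂ (Ψ X) (ball 0 (D.R X))) (hΨmaps : ∀ X, MapsTo (Ψ X) (ball 0 (D.R X)) (ball 0 (R' X))) :
    PieceAdditiveOn (analyticClass R') (D.compCur Ψ R').toC :=
  have hA := admissible_compCur hD hpos hΨan hΨmaps
  pieceAdditiveOn_cur (D.compCur Ψ R') (lt_of_lt_of_le one_pos hA.κ₁_ge) hA.r_pos hA.ϱ_gt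
    (curA_compCur hdirB hpos hΨan hΨmaps) (curC_compCur hD hdirC hdirB R' hΨan)

/-- **ALL FOUR S-BINDERS OF THE NE9 END FOR CURVES OF BAŁABAN'S SHAPE (kernel)** — (w19)'s `sBinders_cur` at the composite datum:
S3 `ChannelAdditive` ∧ S4 `ChannelLocal` ∕ `ChannelStepSum` ∧ S5 `ChannelSizeAtStepNN` for `cpieceChannel (D.compCur Ψ R′).toC` on
`analyticClass R′`, with the weight `weightOf (D.compCur Ψ R′).toC.frame κ₁ d₀ O1 ((D.compCur Ψ R′).Kp c_dir)` (= 64c_dir⁵∕r_k, the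
owner's S5 constant) and the profile `tauOfG c_Q ℓ′`.  Displayed after this: the ray species' `RemData.Admissible ℓ c_dir d₀`, the
GLOBAL ray pair (`hdirC`, `hdirB`) and `0 < dirB` on the shift field, (Ψ1)–(Ψ2) on the background map, the level counts on the
composite frame and the scalars `0 ≤ ℓ`, `0 ≤ O1`, `0 ≤ c_Q·ℓ′`.  NOT PRINTED, not claimed: that Bałaban's objects meet them
(O-NE9-1). [cite: Balaban1987RG1, (3.37) p.277, (3.53)-(3.54) p.280; Balaban1988RG2Cluster, (1.21)-(1.29) pp.7-8, (1.36) p.9] -/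
theorem sBinders_compCur {D : RemData C E ι α β γ δ} {ℓ ℓ' : ℕ → ℕ → ℝ} {cdir d0 O1 cQ : ℝ} (hD : D.Admissible ℓ cdir d0)
    (hpos : ∀ k s y a b x, 0 < D.dirB k s y a b x)
    (hdirC : ∀ k s y a b x, Continuous fun p : ℂ × (δ → ℝ) × (δ → ℂ) => D.dir k s y a b x p.1 p.2.1 p.2.2)
    (hdirB : ∀ k s y a b x t s' σ', ‖D.dir k s y a b x t s' σ'‖ ≤ D.dirB k s y a b x)
    {Ψ : C.Dom → E → E} {R' : C.Dom → ℝ}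
    (hΨan : ∀ X, DifferentiableOn ℂ (Ψ X) (ball 0 (D.R X))) (hΨmaps : ∀ X, MapsTo (Ψ X) (ball 0 (D.R X)) (ball 0 (R' X)))
    (hℓ : ∀ k j, 0 ≤ ℓ k j) (κ : ℝ)
    (hL : LevelCountsG (D.compCur Ψ R').toC.frame κ (D.compCur Ψ R').κ₁ O1 cQ (fun k j => ℓ k j ^ 5) ℓ') (hO1 : 0 ≤ O1)
    (hcQℓ : ∀ k j, 0 ≤ cQ * ℓ' k j) :
    ChannelAdditive (analyticClass R') (cpieceChannel (D.compCur Ψ R').toC) ∧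
      ChannelLocal (analyticClass R') (cpieceChannel (D.compCur Ψ R').toC) ∧
      ChannelStepSum (analyticClass R') (cpieceChannel (D.compCur Ψ R').toC) ∧
      ChannelSizeAtStepNN (analyticClass R') (cpieceChannel (D.compCur Ψ R').toC) κ
        (weightOf (D.compCur Ψ R').toC.frame (D.compCur Ψ R').κ₁ d0 O1 ((D.compCur Ψ R').Kp cdir)) (tauOfG cQ ℓ') :=
  sBinders_cur (admissible_compCur hD hpos hΨan hΨmaps) hℓ κ hL hO1 hcQℓ (curA_compCur hdirB hpos hΨan hΨmaps)
    (curC_compCur hD hdirC hdirB R' hΨan)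

/-! ## §3 Ray consistency: (w16)'s S-binders at the identity background map -/

/-- **CONSISTENCY WITH (w16)** (`NE9Lemma1RemainderSpeciesAdditive.sBinders_rem`, p213082): with the identity background map and
the field radii as chart radii, `D.compCur (fun _ => id) D.R = D.toCur` (`compCur_id`) and `D.toCur.toC = D.toC`
(`RemData.toCur_toC`), both `rfl`; so §2 yields (w16)'s four-binder conclusion for the RAY species' channel `cpieceChannel D.toC`
with the weight `weightOf D.toC.frame κ₁ d₀ O1 (KpOf D c_dir)` — from `hdirC` (as (w16)) and the GLOBAL size `hdirB` + `0 < dirB` in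
place of (w16)'s `hdirR : ‖dir‖ < R_X` (ours is the stronger convention: `hdirB ∧ dirB < R ⟹ hdirR`; it is what a slice disc of
radius `R_X∕dirB > 1` needs).  Nothing landed is lost or contradicted. [folklore] -/
example {D : RemData C E ι α β γ δ} {ℓ ℓ' : ℕ → ℕ → ℝ} {cdir d0 O1 cQ : ℝ} (hD : D.Admissible ℓ cdir d0)
    (hpos : ∀ k s y a b x, 0 < D.dirB k s y a b x)
    (hdirC : ∀ k s y a b x, Continuous fun p : ℂ × (δ → ℝ) × (δ → ℂ) => D.dir k s y a b x p.1 p.2.1 p.2.2)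
    (hdirB : ∀ k s y a b x t s' σ', ‖D.dir k s y a b x t s' σ'‖ ≤ D.dirB k s y a b x)
    (hℓ : ∀ k j, 0 ≤ ℓ k j) (κ : ℝ)
    (hL : LevelCountsG D.toC.frame κ D.κ₁ O1 cQ (fun k j => ℓ k j ^ 5) ℓ') (hO1 : 0 ≤ O1)
    (hcQℓ : ∀ k j, 0 ≤ cQ * ℓ' k j) :
    ChannelAdditive (analyticClass D.R) (cpieceChannel D.toC) ∧
      ChannelLocal (analyticClass D.R) (cpieceChannel D.toC) ∧
      ChannelStepSum (analyticClass D.R) (cpieceChannel D.toC) ∧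
      ChannelSizeAtStepNN (analyticClass D.R) (cpieceChannel D.toC) κ
        (weightOf D.toC.frame D.κ₁ d0 O1 (KpOf D cdir)) (tauOfG cQ ℓ') := by
  have h := sBinders_compCur (Ψ := fun _ => id) (R' := D.R) hD hpos hdirC hdirB (fun X => differentiableOn_id)
    (fun X => mapsTo_id _) hℓ κ (by rw [compCur_id]; exact hL) hO1 hcQℓ
  rw [compCur_id] at h
  exact h

end Summit.QuantumFields.BalabanUV.T4Continuum.NE9CurveFromBackgroundMapAdditive

end
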